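import Mathlib
import HarnessLib
import Literature.ModelTheory.FiniteModelTheory.StructCkEquiv
import Summits.ValiantsHypothesis.ValiantsHypothesis.Theorems.SymmetryDialAffinePebble
import Summits.ValiantsHypothesis.ValiantsHypothesis.Theorems.SymmetryDialTranslationOrbits
import Summits.ValiantsHypothesis.ValiantsHypothesis.Theorems.SymmetryDialDisalignedCFI
import Summits.ValiantsHypothesis.ValiantsHypothesis.Theorems.SymmetryDialDisalignedCFIDisplacement
import Summits.ValiantsHypothesis.ValiantsHypothesis.Theorems.SymmetryDialDisalignedCFIShear
import Summits.ValiantsHypothesis.ValiantsHypothesis.Theorems.SymmetryDialShearStrategy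
import Summits.ValiantsHypothesis.ValiantsHypothesis.Theorems.SymmetryDialShearInvariant

/-!
# Symmetry dial — re-clearing is a linear system (NODE-g9 §B.10/§B.13, lens 1, g9)

The last non-linear-algebra step of the affine-shear lemma (S4).  `affinePebbleEquiv_of_protScheme`
(`SymmetryDialShearInvariant`) reduced the `k`-pebble game on the compact CFI structures to a
RE-CLEARING statement about blocks; `shearMove_of_linear` below reduces that statement to the
solvability of an explicit LINEAR SYSTEM over `𝔽₂` in the unknown shear correction `(ΔL, Δc)`:
agreement on the remaining pinned points (`ΔL(p) + Δc = 0`), on the remaining pebbled duals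
(`ΔLᵀ β = 0`), zero coboundary change on the protected edges that were already protected (KEEP), and a
PRESCRIBED coboundary change on the newly protected edges (CLEAR) — for every prescription.  This is
exactly the existence form of the certifier's rank condition `COND_k` (CLEAR change-functionals
independent modulo the span of the constraint and KEEP functionals).  Ingredients: the coboundary is
additive in the shear (`cobd_add`), the transpose is additive (`transp_add`), and on an edge block
equality of blocks is equivalent to equality of twist values (`twist_eq_of_entry_eq`, one entry
suffices).  Twists enter ordered-pair-wise; the theorem needs no symmetry assumption because the
hypothesis is per ordered protected pair.
-/

set_option linter.dupNamespace false

namespace Summit.ValiantsHypothesis.ValiantsHypothesis.Theorems.SymmetryDialShearLinear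

open Literature.ModelTheory.FiniteModelTheory
open SymmetryDialAffinePebble (V pair Laff affStr AffinePebbleEquiv)
open SymmetryDialTranslationOrbits (pair_add pair_zero_right)
open SymmetryDialDisalignedCFI (base fib Design cfiMat)
open SymmetryDialDisalignedCFIDisplacement (base_append fib_append cfiMat_apply)
open SymmetryDialDisalignedCFIShear (shear cobd transp stdVec)
open SymmetryDialShearStrategy (ShearParam shearSum)
open SymmetryDialShearInvariant (Pos twistOf blockEq_of_twist_eq cfiMat_eq_of_base_eq cfiMat_eq_of_not_adj
  shearSum_agree_inl shearSum_agree_inr)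

variable {d₀ r δ : ℕ}

/-! ## §1 Additivity of the coboundary and of the transpose -/

/-- The coboundary is additive in the shear. -/
theorem cobd_add (D : Design d₀ r δ) (σ σ' : V d₀ → V r) (v w : V d₀) :
    cobd D (fun u => σ u + σ' u) v w = cobd D σ v w + cobd D σ' v w := by
  unfold cobd
  rw [← Finset.sum_add_distrib]
  refine Finset.sum_congr rfl fun i _ => ?_
  split_ifs with h
  · show pair _ (σ v + σ' v) + pair _ (σ w + σ' w) = _
    rw [pair_add, pair_add, add_add_add_comm]
  · rw [add_zero]

/-- The transpose is additive in the linear map. -/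
theorem transp_add (L L' : V d₀ → V r) (β : V r) :
    transp (fun u => L u + L' u) β = transp L β + transp L' β := by
  funext j
  simp only [transp, Pi.add_apply]
  exact pair_add β _ _

/-- The retwist of a corrected shear: old retwist plus the coboundary of the correction. -/
theorem twistOf_correct (D : Design d₀ r δ) (t' : V d₀ → V d₀ → Fin 2) (φ : ShearParam d₀ r)
    (ΔL : V d₀ → V r) (hΔ : ∀ v w, ΔL (v + w) = ΔL v + ΔL w) (Δc : V r) (v w : V d₀) :
    twistOf D t' (⟨fun u => φ.1.1 u + ΔL u, fun a b => by
        show φ.1.1 (a + b) + ΔL (a + b) = (φ.1.1 a + ΔL a) + (φ.1.1 b + ΔL b)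
        rw [φ.1.2, hΔ, add_add_add_comm]⟩, φ.2 + Δc) v w =
      twistOf D t' φ v w + cobd D (fun u => ΔL u + Δc) v w := by
  show t' v w + cobd D (fun u => (φ.1.1 u + ΔL u) + (φ.2 + Δc)) v w =
    t' v w + cobd D (fun u => φ.1.1 u + φ.2) v w + cobd D (fun u => ΔL u + Δc) v w
  have hf : (fun u => (φ.1.1 u + ΔL u) + (φ.2 + Δc)) = fun u => (φ.1.1 u + φ.2) + (ΔL u + Δc) := by
    funext u; exact add_add_add_comm _ _ _ _
  rw [hf, cobd_add, add_assoc]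

/-! ## §2 On an edge, equal blocks means equal twist values -/

/-- On the edge `(v, v + gen i)` one entry of the block decides the twist value: equal `(0,0)`-entries
of `cfiMat D S t` and `cfiMat D S t''` force `t v (v + gen i) = t'' v (v + gen i)`. -/
theorem twist_eq_of_entry_eq (D : Design d₀ r δ) (hD : D.Good) (S : V d₀ → V r → Bool)
    (t t'' : V d₀ → V d₀ → Fin 2) (v : V d₀) (i : Fin δ)
    (h : cfiMat D S t (Fin.append v 0, Fin.append (v + D.gen i) 0) =
      cfiMat D S t'' (Fin.append v 0, Fin.append (v + D.gen i) 0)) :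
    t v (v + D.gen i) = t'' v (v + D.gen i) := by
  have hinj : Function.Injective D.gen := hD.2.1
  have hgen : ∀ i, D.gen i ≠ 0 := hD.2.2.1
  rw [Bool.eq_iff_iff, cfiMat_apply, cfiMat_apply] at h
  simp only [base_append, fib_append, pair_zero_right, add_zero] at h
  have hne : ¬ v = v + D.gen i := by
    intro e
    apply hgen i
    have h2 : v + D.gen i = v + 0 := by rw [add_zero]; exact e.symm
    exact add_left_cancel h2
  have huniq : ∀ i', (v + D.gen i = v + D.gen i') ↔ i' = i :=
    fun i' => ⟨fun e => (hinj (add_left_cancel e)).symm, fun e => by rw [e]⟩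
  simp only [hne, false_and, false_or, huniq, exists_eq_left] at h
  have key : ∀ a b : Fin 2, ((0 = a) ↔ (0 = b)) → a = b := by decide
  exact key _ _ h

/-! ## §3 Re-clearing from the linear system -/

/-- **Re-clearing is a linear system.**  Position `s`, lifted pebble `i`, previous latest pebble
`i₀`, current shear `φ = (L, c)` clean on `prot (s − i₀)`.  Suppose that for EVERY prescription `d` of
values on ordered edges there is a correction `(ΔL, Δc)` (`ΔL` additive) with: `ΔL(base x) + Δc = 0`
for the points `x` under pebbles `j ≠ i`; `ΔLᵀ (fib ξ) = 0` for the duals `ξ` under pebbles `j ≠ i`;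
and on every protected edge `(v, v + gen idx) ∈ prot (s − i)` the coboundary change is `0` if the edge
was already in `prot (s − i₀)` and `d v (v + gen idx)` otherwise.  Then there is a corrected shear
agreeing with `φ` on the pebbles `j ≠ i` and clean on `prot (s − i)` — the `hmove` clause of
`affinePebbleEquiv_of_protScheme`. -/
theorem shearMove_of_linear {k : ℕ} (D : Design d₀ r δ) (hD : D.Good) (S : V d₀ → V r → Bool)
    (t t' : V d₀ → V d₀ → Fin 2) (prot : Pos k (d₀ + r) → V d₀ → V d₀ → Prop)
    (φ : ShearParam d₀ r) (s : Pos k (d₀ + r)) (i i₀ : Fin k)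
    (hclean : ∀ v w, prot (Function.update s i₀ none) v w → ∀ a b : V r,
      cfiMat D S t (Fin.append v a, Fin.append w b) =
        cfiMat D S (twistOf D t' φ) (Fin.append v a, Fin.append w b))
    (hlin : ∀ d : V d₀ → V d₀ → Fin 2, ∃ (ΔL : V d₀ → V r) (Δc : V r),
      (∀ v w, ΔL (v + w) = ΔL v + ΔL w) ∧
      (∀ j, j ≠ i → ∀ x, s j = some (.inl x) → ΔL (base x) + Δc = 0) ∧
      (∀ j, j ≠ i → ∀ ξ, s j = some (.inr ξ) → transp ΔL (fib ξ) = 0) ∧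
      (∀ (v : V d₀) (idx : Fin δ), prot (Function.update s i none) v (v + D.gen idx) →
        (prot (Function.update s i₀ none) v (v + D.gen idx) →
          cobd D (fun u => ΔL u + Δc) v (v + D.gen idx) = 0) ∧
        (¬ prot (Function.update s i₀ none) v (v + D.gen idx) →
          cobd D (fun u => ΔL u + Δc) v (v + D.gen idx) = d v (v + D.gen idx)))) :
    ∃ φ' : ShearParam d₀ r,
      (∀ j, j ≠ i → ∀ z, s j = some z → shearSum φ'.1.1 φ'.2 z = shearSum φ.1.1 φ.2 z) ∧
      ∀ v w, prot (Function.update s i none) v w → ∀ a b : V r,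
        cfiMat D S t (Fin.append v a, Fin.append w b) =
          cfiMat D S (twistOf D t' φ') (Fin.append v a, Fin.append w b) := by
  classical
  obtain ⟨ΔL, Δc, hadd, hpts, hduals, hedges⟩ := hlin fun v w => t v w + twistOf D t' φ v w
  refine ⟨(⟨fun u => φ.1.1 u + ΔL u, fun a b => by
      show φ.1.1 (a + b) + ΔL (a + b) = (φ.1.1 a + ΔL a) + (φ.1.1 b + ΔL b)
      rw [φ.1.2, hadd, add_add_add_comm]⟩, φ.2 + Δc), ?_, ?_⟩
  · intro j hj z hz
    cases z with
    | inl x =>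
      rw [shearSum_agree_inl]
      show (φ.1.1 (base x) + ΔL (base x)) + (φ.2 + Δc) = φ.1.1 (base x) + φ.2
      rw [add_add_add_comm, hpts j hj x hz, add_zero]
    | inr ξ =>
      rw [shearSum_agree_inr]
      show transp (fun u => φ.1.1 u + ΔL u) (fib ξ) = transp φ.1.1 (fib ξ)
      rw [transp_add, hduals j hj ξ hz, add_zero]
  · intro v w hp a b
    by_cases hvw : v = w
    · subst hvw
      exact cfiMat_eq_of_base_eq D hD.2.2.1 S _ _ _ _ (by rw [base_append, base_append])
    by_cases hadj : ∃ idx, w = v + D.gen idx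
    · obtain ⟨idx, rfl⟩ := hadj
      refine blockEq_of_twist_eq D S t _ v _ ?_ a b
      rw [twistOf_correct D t' φ ΔL hadd Δc]
      obtain ⟨hk, hc⟩ := hedges v idx hp
      by_cases hq : prot (Function.update s i₀ none) v (v + D.gen idx)
      · rw [hk hq, add_zero]
        exact twist_eq_of_entry_eq D hD S t _ v idx (hclean v _ hq 0 0)
      · rw [hc hq]
        generalize t v (v + D.gen idx) = a₁
        generalize twistOf D t' φ v (v + D.gen idx) = b₁
        revert a₁ b₁; decide
    · exact cfiMat_eq_of_not_adj D S _ _ _ _ (by rw [base_append, base_append]; exact hvw)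
        (fun idx => by rw [base_append, base_append]; exact fun e => hadj ⟨idx, e⟩)

end Summit.ValiantsHypothesis.ValiantsHypothesis.Theorems.SymmetryDialShearLinear
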